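import Mathlib
import Literature.Analysis.FluidPDE.AxisDistancePowerIntegral
import Literature.Analysis.FluidPDE.AxisymmetricVorticityTransport
import HarnessLib.Audit

/-!
# Crux E `EulerZoomLiouville.PowerGaugeEulerLiouville` — the needle stratum: TONELLI IN SPHERICAL
# COORDINATES and the sphere-by-sphere reduction of axisymmetric budgets (ROUND-37 gap G4)

Route №10 `EulerZoomLiouville` (NavierStokesRegularity), crux E = stmt-NavierStokesRegularity-19832,
registered residue `stub_selfSimilarC2Needle`, memo ROUND-37 of the cell `ns-regularity-ideate`
(nsreg-p2), typing gap **G4** «spherical coordinates for axisymmetric integrands».  Pure measure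
theory on `ℝ³ = EuclideanSpace ℝ (Fin 3)`; no fluid mechanics is used, only the tree's cylindrical
Tonelli (`lintegral_eq_lintegral_cylindrical`'s ingredients `cylSplit`, `lintegral_eq_lintegral_planePolar`)
and Mathlib's planar polar coordinates a second time, in the meridian half-plane.

* `sphericalPt t θ φ = (t sin θ cos φ, t sin θ sin φ, t cos θ)`; `‖sphericalPt t θ φ‖ = |t|`,
  `r⊥ = |t sin θ|`, `rotZ φ (sphericalPt t θ 0) = sphericalPt t θ φ`,
  `sphericalPt t θ 0 = meridianPoint (t sin θ, t cos θ)`.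
* **`lintegral_eq_lintegral_spherical`** — for measurable `G : ℝ³ → ℝ≥0∞`,
  `∫⁻ G = ∫⁻_{φ ∈ (−π,π)} ∫⁻_{t > 0} ∫⁻_{θ ∈ (0,π)} t² sin θ · G(sphericalPt t θ φ)`.
* **`lintegral_eq_lintegral_spherical_of_axisymmetric`** — for an axisymmetric scalar
  (`IsAxisymmetricScalar G`): `∫⁻ G = 2π ∫⁻_{t>0} ∫⁻_{θ ∈ (0,π)} t² sin θ · G(sphericalPt t θ 0)`,
  and its SHELL form `setLIntegral_shell_eq_spherical_of_axisymmetric`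
  (`∫⁻_{a < ‖x‖ < b} G = 2π ∫⁻_{t ∈ (a,b)} ∫⁻_{θ∈(0,π)} …`, `0 ≤ a`): the radial variable is
  OUTERMOST, so «for most radii `t` the sphere `S_t` carries at most `4/L` of the shell budget»
  is one Chebyshev step (`volume_setOf_sphereBudget_ge_le`).
* `hasDerivAt_sphericalPt_theta`, `norm_sphericalTangentTheta`, `hasDerivAt_comp_sphericalPt_theta`,
  `norm_deriv_comp_sphericalPt_theta_le` — the meridian profile `θ ↦ g(sphericalPt t θ φ)` of a
  differentiable scalar has derivative `Dg · ∂_θ`, `‖∂_θ‖ = |t|`, so `|f′(θ)|² ≤ t² ‖Dg‖²`: the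
  1-D Dirichlet integral of ROUND-37's band lemma (plate t38a, `NeedleAxisymBand.sin_le_of_band`)
  is dominated by the sphere's share of the 3-D Dirichlet budget.
* `isAxisymmetricScalar_norm`, `isAxisymmetricScalar_inner_self`, `isAxisymmetricScalar_norm_fderiv`
  — the integrands of the needle's budgets (`‖V‖`, `⟪y, V y⟫`, `‖∇V‖`) are axisymmetric scalars
  when `V` is an axisymmetric field.

References: Evans–Gariepy, *Measure Theory and Fine Properties of Functions* (2015) §3.4.4
(polar coordinates) with §1.4 (Fubini); Koch–Nadirashvili–Seregin–Šverák, Acta Math. 203 (2009),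
proof of Thm 5.3 (`dx = r dr dθ dz`).
-/

set_option linter.dupNamespace false

noncomputable section

open Set Filter MeasureTheory Topology
open scoped ENNReal NNReal
open Literature.Analysis Literature.Analysis.FluidPDE

namespace Summit.NavierStokesRegularity.NavierStokesRegularity.Theorems.PowerGaugeEulerLiouville.NeedleSphericalTonelli

/-! ### Spherical points -/

/-- The point with spherical coordinates `(t, θ, φ)` about the `x 2`-axis:
`(t sin θ cos φ, t sin θ sin φ, t cos θ)` (`θ` = polar angle from the axis, `φ` = azimuth). [folklore] -/
def sphericalPt (t θ φ : ℝ) : EuclideanSpace ℝ (Fin 3) :=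
  WithLp.toLp 2 ![t * Real.sin θ * Real.cos φ, t * Real.sin θ * Real.sin φ, t * Real.cos θ]

/-- Component `0` of a spherical point. [folklore] -/
@[simp] theorem sphericalPt_apply_zero (t θ φ : ℝ) :
    sphericalPt t θ φ 0 = t * Real.sin θ * Real.cos φ := rfl

/-- Component `1` of a spherical point. [folklore] -/
@[simp] theorem sphericalPt_apply_one (t θ φ : ℝ) :
    sphericalPt t θ φ 1 = t * Real.sin θ * Real.sin φ := rfl

/-- Component `2` of a spherical point. [folklore] -/
@[simp] theorem sphericalPt_apply_two (t θ φ : ℝ) : sphericalPt t θ φ 2 = t * Real.cos θ := rfl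

/-- `‖sphericalPt t θ φ‖ = |t|`. [folklore] -/
theorem norm_sphericalPt (t θ φ : ℝ) : ‖sphericalPt t θ φ‖ = |t| := by
  rw [EuclideanSpace.norm_eq, Fin.sum_univ_three, ← Real.sqrt_sq_eq_abs]
  congr 1
  simp only [sphericalPt_apply_zero, sphericalPt_apply_one, sphericalPt_apply_two, Real.norm_eq_abs,
    sq_abs]
  linear_combination t ^ 2 * Real.sin θ ^ 2 * Real.sin_sq_add_cos_sq φ +
    t ^ 2 * Real.sin_sq_add_cos_sq θ

/-- `r⊥(sphericalPt t θ φ) = |t sin θ|`. [folklore] -/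
theorem cylRadius_sphericalPt (t θ φ : ℝ) : cylRadius (sphericalPt t θ φ) = |t * Real.sin θ| := by
  rw [cylRadius, ← Real.sqrt_sq_eq_abs]
  congr 1
  simp only [sphericalPt_apply_zero, sphericalPt_apply_one]
  linear_combination (t * Real.sin θ) ^ 2 * Real.sin_sq_add_cos_sq φ

/-- Rotating the meridian point by the azimuth: `rotZ φ (sphericalPt t θ 0) = sphericalPt t θ φ`.
[folklore] -/
theorem rotZ_sphericalPt_zero (t θ φ : ℝ) : rotZ φ (sphericalPt t θ 0) = sphericalPt t θ φ := by
  ext i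
  fin_cases i <;> simp [rotZ, sphericalPt] <;> ring

/-- The meridian point of the tree: `sphericalPt t θ 0 = meridianPoint (t sin θ, t cos θ)`. [folklore] -/
theorem sphericalPt_zero_eq_meridianPoint (t θ : ℝ) :
    sphericalPt t θ 0 = meridianPoint (t * Real.sin θ, t * Real.cos θ) := by
  ext i
  fin_cases i <;> simp [sphericalPt, meridianPoint]

/-- An axisymmetric scalar does not see the azimuth: `G (sphericalPt t θ φ) = G (sphericalPt t θ 0)`.
[folklore] -/
theorem _root_.Literature.Analysis.FluidPDE.IsAxisymmetricScalar.apply_sphericalPt {α : Sort*}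
    {G : EuclideanSpace ℝ (Fin 3) → α} (hG : IsAxisymmetricScalar G) (t θ φ : ℝ) :
    G (sphericalPt t θ φ) = G (sphericalPt t θ 0) := by
  rw [← rotZ_sphericalPt_zero, hG]

/-- Continuity of `(t, θ) ↦ sphericalPt t θ φ`. [folklore] -/
theorem continuous_sphericalPt_left (φ : ℝ) :
    Continuous fun p : ℝ × ℝ => sphericalPt p.1 p.2 φ := by
  refine (PiLp.continuous_toLp 2 _).comp (continuous_pi fun i => ?_)
  fin_cases i
  · exact ((continuous_fst.mul (Real.continuous_sin.comp continuous_snd)).mul continuous_const)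
  · exact ((continuous_fst.mul (Real.continuous_sin.comp continuous_snd)).mul continuous_const)
  · exact continuous_fst.mul (Real.continuous_cos.comp continuous_snd)

/-- The cylindrical point `(ρ cos φ, ρ sin φ, z)` (private plumbing). [folklore] -/
def cylPt (φ : ℝ) (p : ℝ × ℝ) : EuclideanSpace ℝ (Fin 3) :=
  WithLp.toLp 2 ![p.2 * Real.cos φ, p.2 * Real.sin φ, p.1]

/-- Continuity of `(z, ρ) ↦ (ρ cos φ, ρ sin φ, z)`. [folklore] -/
theorem continuous_cylPt (φ : ℝ) : Continuous (cylPt φ) := by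
  refine (PiLp.continuous_toLp 2 _).comp (continuous_pi fun i => ?_)
  fin_cases i
  · exact continuous_snd.mul continuous_const
  · exact continuous_snd.mul continuous_const
  · exact continuous_fst

/-- `cylSplit.symm (z, (ρ cos φ, ρ sin φ)) = cylPt φ (z, ρ)`. [folklore] -/
theorem cylSplit_symm_polar (φ z ρ : ℝ) :
    cylSplit.symm (z, (WithLp.toLp 2 ![ρ * Real.cos φ, ρ * Real.sin φ] : EuclideanSpace ℝ (Fin 2))) =
      cylPt φ (z, ρ) := by
  rw [cylSplit_symm_apply]
  rfl

/-- In meridian polar coordinates the cylindrical point is the spherical point: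
`cylPt φ (t cos θ, t sin θ) = sphericalPt t θ φ`. [folklore] -/
theorem cylPt_polar (φ t θ : ℝ) : cylPt φ (t * Real.cos θ, t * Real.sin θ) = sphericalPt t θ φ := rfl

/-! ### Tonelli in spherical coordinates -/

/-- The meridian half-plane step: for fixed azimuth `φ`,
`∫⁻_{ρ>0} ρ ∫⁻_z G(ρ cos φ, ρ sin φ, z) = ∫⁻_{t>0} ∫⁻_{θ∈(0,π)} t² sin θ · G(sphericalPt t θ φ)`
(planar polar coordinates `(z, ρ) = (t cos θ, t sin θ)` in the half-plane `ρ > 0`). [folklore] -/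
theorem lintegral_meridian_eq_polar {G : EuclideanSpace ℝ (Fin 3) → ℝ≥0∞} (hG : Measurable G) (φ : ℝ) :
    ∫⁻ ρ in Ioi (0 : ℝ), ENNReal.ofReal ρ * ∫⁻ z : ℝ, G (cylPt φ (z, ρ)) =
      ∫⁻ t in Ioi (0 : ℝ), ∫⁻ θ in Ioo 0 Real.pi,
        ENNReal.ofReal (t ^ 2 * Real.sin θ) * G (sphericalPt t θ φ) := by
  -- the half-plane integrand on `ℝ × ℝ = (z, ρ)`
  set f : ℝ × ℝ → ℝ≥0∞ := fun p =>
    ({p : ℝ × ℝ | 0 < p.2}).indicator (fun p => ENNReal.ofReal p.2 * G (cylPt φ p)) p with hf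
  have hGc : Measurable fun p : ℝ × ℝ => G (cylPt φ p) := hG.comp (continuous_cylPt φ).measurable
  have hfm : Measurable f :=
    ((ENNReal.measurable_ofReal.comp measurable_snd).mul hGc).indicator
      (measurableSet_lt measurable_const measurable_snd)
  -- LHS = ∫⁻ f
  have hL : ∫⁻ ρ in Ioi (0 : ℝ), ENNReal.ofReal ρ * ∫⁻ z : ℝ, G (cylPt φ (z, ρ)) = ∫⁻ p, f p := by
    rw [Measure.volume_eq_prod, lintegral_prod_symm _ hfm.aemeasurable, ← lintegral_indicator measurableSet_Ioi]
    refine lintegral_congr fun ρ => ?_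
    by_cases hρ : ρ ∈ Ioi (0 : ℝ)
    · have hm : Measurable fun z : ℝ => G (cylPt φ (z, ρ)) :=
        hGc.comp (measurable_id.prodMk measurable_const)
      rw [indicator_of_mem hρ, ← lintegral_const_mul _ hm]
      refine lintegral_congr fun z => ?_
      have hmem : (z, ρ) ∈ {p : ℝ × ℝ | 0 < p.2} := hρ
      simp only [hf, indicator_of_mem hmem]
    · rw [indicator_of_notMem hρ]
      symm
      refine (lintegral_congr fun z => ?_).trans lintegral_zero
      have hnm : (z, ρ) ∉ {p : ℝ × ℝ | 0 < p.2} := hρ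
      simp only [hf, indicator_of_notMem hnm]
  rw [hL, ← lintegral_comp_polarCoord_symm f, Calculus.volume_restrict_polarCoord_target,
    lintegral_prod _ ?_]
  swap
  · refine Measurable.aemeasurable ?_
    refine (ENNReal.measurable_ofReal.comp measurable_fst).smul (hfm.comp ?_)
    exact (continuous_fst.mul (Real.continuous_cos.comp continuous_snd)).measurable.prodMk
      (continuous_fst.mul (Real.continuous_sin.comp continuous_snd)).measurable
  refine setLIntegral_congr_fun measurableSet_Ioi fun t ht => ?_
  -- inner θ-integral at radius `t > 0`
  have hsub : Ioo 0 Real.pi ⊆ Ioo (-Real.pi) Real.pi := Ioo_subset_Ioo (by linarith [Real.pi_pos]) le_rfl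
  have hind : ∀ θ ∈ Ioo (-Real.pi) Real.pi,
      ENNReal.ofReal t • f (polarCoord.symm (t, θ)) =
        (Ioo 0 Real.pi).indicator
          (fun θ => ENNReal.ofReal (t ^ 2 * Real.sin θ) * G (sphericalPt t θ φ)) θ := by
    intro θ hθ
    rw [polarCoord_symm_apply, smul_eq_mul, hf]
    simp only
    by_cases hθ' : θ ∈ Ioo 0 Real.pi
    · have hsin : 0 < Real.sin θ := Real.sin_pos_of_pos_of_lt_pi hθ'.1 hθ'.2
      have hmem : (t * Real.cos θ, t * Real.sin θ) ∈ {p : ℝ × ℝ | 0 < p.2} := mul_pos ht hsin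
      rw [indicator_of_mem hmem, indicator_of_mem hθ', cylPt_polar, ← mul_assoc,
        ← ENNReal.ofReal_mul ht.le, show t * (t * Real.sin θ) = t ^ 2 * Real.sin θ by ring]
    · have hsin : Real.sin θ ≤ 0 := by
        have hθ0 : θ ≤ 0 := by
          by_contra h
          exact hθ' ⟨lt_of_not_ge h, hθ.2⟩
        exact Real.sin_nonpos_of_nonpos_of_neg_pi_le hθ0 hθ.1.le
      have hnm : (t * Real.cos θ, t * Real.sin θ) ∉ {p : ℝ × ℝ | 0 < p.2} := by
        simp only [mem_setOf_eq, not_lt]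
        exact mul_nonpos_of_nonneg_of_nonpos ht.le hsin
      rw [indicator_of_notMem hnm, indicator_of_notMem hθ', mul_zero]
  rw [setLIntegral_congr_fun measurableSet_Ioo hind, lintegral_indicator measurableSet_Ioo,
    Measure.restrict_restrict measurableSet_Ioo, inter_eq_left.2 hsub]

/-- **Tonelli in spherical coordinates on `ℝ³`.**  For a non-negative measurable `G`,
`∫⁻ G = ∫⁻_{φ∈(−π,π)} ∫⁻_{t>0} ∫⁻_{θ∈(0,π)} t² sin θ · G(t sin θ cos φ, t sin θ sin φ, t cos θ)`
(Fubini in `(x₂, x')`, planar polar coordinates in `x'`, then planar polar coordinates in the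
meridian half-plane).  [cite: EvansGariepy2015, §3.4.4 (polar coordinates, with Fubini §1.4)] -/
theorem lintegral_eq_lintegral_spherical {G : EuclideanSpace ℝ (Fin 3) → ℝ≥0∞} (hG : Measurable G) :
    ∫⁻ x, G x = ∫⁻ φ in Ioo (-Real.pi) Real.pi, ∫⁻ t in Ioi (0 : ℝ), ∫⁻ θ in Ioo 0 Real.pi,
      ENNReal.ofReal (t ^ 2 * Real.sin θ) * G (sphericalPt t θ φ) := by
  have h1 : ∫⁻ x, G x = ∫⁻ p : ℝ × EuclideanSpace ℝ (Fin 2), G (cylSplit.symm p) :=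
    (measurePreserving_cylSplit_symm.lintegral_comp_emb cylSplit.symm.measurableEmbedding G).symm
  have hGm : Measurable fun p : ℝ × EuclideanSpace ℝ (Fin 2) => G (cylSplit.symm p) :=
    hG.comp cylSplit.symm.measurable
  have hFm : Measurable fun w : EuclideanSpace ℝ (Fin 2) => ∫⁻ z : ℝ, G (cylSplit.symm (z, w)) :=
    hGm.lintegral_prod_left'
  rw [h1, Measure.volume_eq_prod, lintegral_prod_symm _ hGm.aemeasurable,
    lintegral_eq_lintegral_planePolar hFm]
  refine setLIntegral_congr_fun measurableSet_Ioo fun φ _ => ?_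
  simp only [cylSplit_symm_polar]
  exact lintegral_meridian_eq_polar hG φ

/-- **Spherical Tonelli for axisymmetric scalars** — the azimuth integrates out:
`∫⁻ G = 2π ∫⁻_{t>0} ∫⁻_{θ∈(0,π)} t² sin θ · G(sphericalPt t θ 0)` (`dx = 2π t² sin θ dθ dt` for
integrands not depending on the azimuth). [cite: KochNadirashviliSereginSverak2009, proof of Thm 5.3, (5.19) (arXiv p. 10)] -/
theorem lintegral_eq_lintegral_spherical_of_axisymmetric {G : EuclideanSpace ℝ (Fin 3) → ℝ≥0∞}
    (hG : Measurable G) (hax : IsAxisymmetricScalar G) :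
    ∫⁻ x, G x = ENNReal.ofReal (2 * Real.pi) * ∫⁻ t in Ioi (0 : ℝ), ∫⁻ θ in Ioo 0 Real.pi,
      ENNReal.ofReal (t ^ 2 * Real.sin θ) * G (sphericalPt t θ 0) := by
  rw [lintegral_eq_lintegral_spherical hG]
  have h : ∀ φ ∈ Ioo (-Real.pi) Real.pi,
      (∫⁻ t in Ioi (0 : ℝ), ∫⁻ θ in Ioo 0 Real.pi,
          ENNReal.ofReal (t ^ 2 * Real.sin θ) * G (sphericalPt t θ φ)) =
        ∫⁻ t in Ioi (0 : ℝ), ∫⁻ θ in Ioo 0 Real.pi,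
          ENNReal.ofReal (t ^ 2 * Real.sin θ) * G (sphericalPt t θ 0) := by
    intro φ _
    simp only [hax.apply_sphericalPt]
  rw [setLIntegral_congr_fun measurableSet_Ioo h, setLIntegral_const, Real.volume_Ioo, mul_comm,
    show Real.pi - -Real.pi = 2 * Real.pi by ring]

/-- The shell `a < ‖x‖ < b` is a measurable set. [folklore] -/
theorem measurableSet_shell (a b : ℝ) :
    MeasurableSet {x : EuclideanSpace ℝ (Fin 3) | a < ‖x‖ ∧ ‖x‖ < b} :=
  (measurableSet_lt measurable_const continuous_norm.measurable).inter
    (measurableSet_lt continuous_norm.measurable measurable_const)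

/-- **Shell form.**  For an axisymmetric scalar and `0 ≤ a`:
`∫⁻_{a<‖x‖<b} G = 2π ∫⁻_{t∈(a,b)} ∫⁻_{θ∈(0,π)} t² sin θ · G(sphericalPt t θ 0)` — the radius is the
OUTER variable, the inner integral is the (weighted) integral over the sphere `S_t`.
[cite: KochNadirashviliSereginSverak2009, proof of Thm 5.3, (5.19) (arXiv p. 10)] -/
theorem setLIntegral_shell_eq_spherical_of_axisymmetric {G : EuclideanSpace ℝ (Fin 3) → ℝ≥0∞}
    (hG : Measurable G) (hax : IsAxisymmetricScalar G) {a b : ℝ} (ha : 0 ≤ a) :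
    ∫⁻ x in {x | a < ‖x‖ ∧ ‖x‖ < b}, G x =
      ENNReal.ofReal (2 * Real.pi) * ∫⁻ t in Ioo a b, ∫⁻ θ in Ioo 0 Real.pi,
        ENNReal.ofReal (t ^ 2 * Real.sin θ) * G (sphericalPt t θ 0) := by
  set S : Set (EuclideanSpace ℝ (Fin 3)) := {x | a < ‖x‖ ∧ ‖x‖ < b} with hS
  have hSm : MeasurableSet S := measurableSet_shell a b
  have hSax : IsAxisymmetricScalar (S.indicator G) := by
    intro θ x
    simp only [indicator, hS, mem_setOf_eq, norm_rotZ, hax θ x]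
  rw [← lintegral_indicator hSm, lintegral_eq_lintegral_spherical_of_axisymmetric (hG.indicator hSm) hSax]
  congr 1
  rw [← lintegral_indicator measurableSet_Ioo, ← lintegral_indicator measurableSet_Ioi]
  refine lintegral_congr fun t => ?_
  by_cases ht : t ∈ Ioo a b
  · have ht0 : 0 < t := lt_of_le_of_lt ha ht.1
    rw [indicator_of_mem ht, indicator_of_mem (show t ∈ Ioi (0 : ℝ) from ht0)]
    refine setLIntegral_congr_fun measurableSet_Ioo fun θ _ => ?_
    have hmem : sphericalPt t θ 0 ∈ S := by
      simp only [hS, mem_setOf_eq, norm_sphericalPt, abs_of_pos ht0]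
      exact ht
    rw [indicator_of_mem hmem]
  · rw [indicator_of_notMem ht]
    by_cases ht0 : 0 < t
    · rw [indicator_of_mem (show t ∈ Ioi (0 : ℝ) from ht0)]
      refine (setLIntegral_congr_fun measurableSet_Ioo fun θ _ => ?_).trans lintegral_zero
      have hnm : sphericalPt t θ 0 ∉ S := by
        simp only [hS, mem_setOf_eq, norm_sphericalPt, abs_of_pos ht0]
        exact ht
      simp only [indicator_of_notMem hnm, mul_zero]
    · rw [indicator_of_notMem (show t ∉ Ioi (0 : ℝ) from ht0)]

/-- **Good radii by Chebyshev.**  If the shell budget is `∫⁻_{t∈(a,b)} Φ t ≤ B`, the radii whose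
sphere carries at least `ε` have measure at most `B/ε`:  `volume ({t | ε ≤ Φ t} ∩ (a,b)) ≤ B/ε`
(`0 < ε < ∞`; with `ε = 4B/(b−a)` three quarters of the radii are GOOD). [folklore] -/
theorem volume_setOf_sphereBudget_ge_le {Φ : ℝ → ℝ≥0∞} (hΦ : Measurable Φ) {a b : ℝ} {B ε : ℝ≥0∞}
    (hB : ∫⁻ t in Ioo a b, Φ t ≤ B) (hε : ε ≠ 0) (hε' : ε ≠ ∞) :
    volume ({t | ε ≤ Φ t} ∩ Ioo a b) ≤ B / ε := by
  have hmk := meas_ge_le_lintegral_div (μ := volume.restrict (Ioo a b)) hΦ.aemeasurable hε hε'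
  rw [Measure.restrict_apply' measurableSet_Ioo] at hmk
  exact hmk.trans (ENNReal.div_le_div_right hB _)

/-! ### The meridian profile along a sphere: `θ ↦ g (sphericalPt t θ φ)` -/

/-- The `θ`-tangent of the spherical coordinate map: `∂_θ sphericalPt = (t cos θ cos φ,
t cos θ sin φ, −t sin θ)`. [folklore] -/
def sphericalTangentTheta (t θ φ : ℝ) : EuclideanSpace ℝ (Fin 3) :=
  WithLp.toLp 2 ![t * Real.cos θ * Real.cos φ, t * Real.cos θ * Real.sin φ, -(t * Real.sin θ)]

/-- `‖∂_θ sphericalPt‖ = |t|` (the polar angle is arclength / radius). [folklore] -/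
theorem norm_sphericalTangentTheta (t θ φ : ℝ) : ‖sphericalTangentTheta t θ φ‖ = |t| := by
  rw [EuclideanSpace.norm_eq, Fin.sum_univ_three, ← Real.sqrt_sq_eq_abs]
  congr 1
  simp only [sphericalTangentTheta, PiLp.toLp_apply, Matrix.cons_val_zero, Matrix.cons_val_one,
    Matrix.cons_val, Real.norm_eq_abs, sq_abs]
  linear_combination t ^ 2 * Real.cos θ ^ 2 * Real.sin_sq_add_cos_sq φ +
    t ^ 2 * Real.sin_sq_add_cos_sq θ

/-- `d/dθ sphericalPt t θ φ = sphericalTangentTheta t θ φ`. [folklore] -/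
theorem hasDerivAt_sphericalPt_theta (t θ φ : ℝ) :
    HasDerivAt (fun θ => sphericalPt t θ φ) (sphericalTangentTheta t θ φ) θ := by
  set a : EuclideanSpace ℝ (Fin 3) := WithLp.toLp 2 ![Real.cos φ, Real.sin φ, 0] with ha
  set b : EuclideanSpace ℝ (Fin 3) := WithLp.toLp 2 ![0, 0, 1] with hb
  have hrepr : (fun θ => sphericalPt t θ φ) = fun θ => (t * Real.sin θ) • a + (t * Real.cos θ) • b := by
    funext θ'
    ext i
    fin_cases i <;> simp [sphericalPt, ha, hb]
  have htan : sphericalTangentTheta t θ φ =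
      (t * Real.cos θ) • a + (t * -Real.sin θ) • b := by
    ext i
    fin_cases i <;> simp [sphericalTangentTheta, ha, hb]
  rw [hrepr, htan]
  exact (((Real.hasDerivAt_sin θ).const_mul t).smul_const a).add
    (((Real.hasDerivAt_cos θ).const_mul t).smul_const b)

/-- **Chain rule along the meridian arc of the sphere `S_t`**: for `g` differentiable at the point,
`d/dθ g(sphericalPt t θ φ) = Dg · ∂_θ`. [folklore] -/
theorem hasDerivAt_comp_sphericalPt_theta {F : Type*} [NormedAddCommGroup F] [NormedSpace ℝ F]
    {g : EuclideanSpace ℝ (Fin 3) → F} {t θ φ : ℝ} (hd : DifferentiableAt ℝ g (sphericalPt t θ φ)) :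
    HasDerivAt (fun θ => g (sphericalPt t θ φ))
      (fderiv ℝ g (sphericalPt t θ φ) (sphericalTangentTheta t θ φ)) θ :=
  hd.hasFDerivAt.comp_hasDerivAt θ (hasDerivAt_sphericalPt_theta t θ φ)

/-- The arc derivative is dominated by the full gradient: `‖d/dθ g(sphericalPt t θ φ)‖ ≤ |t| ‖Dg‖`
— so the 1-D Dirichlet integral `∫ |f′(θ)|² dθ` of a meridian profile on `S_t` is at most
`t² ∫ ‖Dg(sphericalPt t θ φ)‖² dθ`, the sphere's share of the 3-D budget in
`setLIntegral_shell_eq_spherical_of_axisymmetric` up to the weight `sin θ`. [folklore] -/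
theorem norm_deriv_comp_sphericalPt_theta_le {F : Type*} [NormedAddCommGroup F] [NormedSpace ℝ F]
    {g : EuclideanSpace ℝ (Fin 3) → F} {t θ φ : ℝ} (hd : DifferentiableAt ℝ g (sphericalPt t θ φ)) :
    ‖deriv (fun θ => g (sphericalPt t θ φ)) θ‖ ≤ |t| * ‖fderiv ℝ g (sphericalPt t θ φ)‖ := by
  rw [(hasDerivAt_comp_sphericalPt_theta hd).deriv, mul_comm, ← norm_sphericalTangentTheta t θ φ]
  exact ContinuousLinearMap.le_opNorm _ _

/-! ### The needle's budget integrands are axisymmetric scalars -/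

/-- `‖V‖` is an axisymmetric scalar for an axisymmetric field `V`. [folklore] -/
theorem isAxisymmetricScalar_norm {V : EuclideanSpace ℝ (Fin 3) → EuclideanSpace ℝ (Fin 3)}
    (hV : IsAxisymmetric V) : IsAxisymmetricScalar fun y => ‖V y‖ := by
  intro θ x
  simp only [hV θ x, norm_rotZ]

/-- `⟪y, V y⟫` (the radial flux density of the needle) is an axisymmetric scalar for an
axisymmetric field `V`. [folklore] -/
theorem isAxisymmetricScalar_inner_self {V : EuclideanSpace ℝ (Fin 3) → EuclideanSpace ℝ (Fin 3)}
    (hV : IsAxisymmetric V) : IsAxisymmetricScalar fun y => inner ℝ y (V y) := by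
  intro θ x
  simp only [hV θ x]
  rw [← rotZLIE_apply, ← rotZLIE_apply, LinearIsometryEquiv.inner_map_map]

/-- `rotZL θ` is the continuous linear map of the isometry `rotZLIE θ`. [folklore] -/
theorem rotZL_eq_coe_rotZLIE (θ : ℝ) :
    rotZL θ = ((rotZLIE θ : EuclideanSpace ℝ (Fin 3) ≃ₗᵢ[ℝ] EuclideanSpace ℝ (Fin 3)) :
      EuclideanSpace ℝ (Fin 3) →L[ℝ] EuclideanSpace ℝ (Fin 3)) := by
  ext1 x
  rfl

/-- **`‖∇V‖` is an axisymmetric scalar** for an axisymmetric everywhere-differentiable field: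
`DV(R_θ x) = R_θ ∘ DV(x) ∘ R_{−θ}` (tree `IsAxisymmetric.fderiv_rotZ`) and conjugation by
isometries preserves the operator norm. [folklore] -/
theorem isAxisymmetricScalar_norm_fderiv {V : EuclideanSpace ℝ (Fin 3) → EuclideanSpace ℝ (Fin 3)}
    (hV : IsAxisymmetric V) (hd : Differentiable ℝ V) :
    IsAxisymmetricScalar fun y => ‖fderiv ℝ V y‖ := by
  intro θ x
  simp only [hV.fderiv_rotZ hd θ x, rotZL_eq_coe_rotZLIE,
    ContinuousLinearMap.opNorm_linearIsometryEquiv_comp, ContinuousLinearMap.opNorm_comp_linearIsometryEquiv]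

/-- Hence also `‖∇V‖ₑ ^ 2` (the Dirichlet integrand, as an extended non-negative real) is an
axisymmetric scalar. [folklore] -/
theorem isAxisymmetricScalar_enorm_fderiv_sq {V : EuclideanSpace ℝ (Fin 3) → EuclideanSpace ℝ (Fin 3)}
    (hV : IsAxisymmetric V) (hd : Differentiable ℝ V) :
    IsAxisymmetricScalar fun y => (‖fderiv ℝ V y‖ₑ : ℝ≥0∞) ^ 2 := by
  intro θ x
  have h := isAxisymmetricScalar_norm_fderiv hV hd θ x
  simp only at h ⊢
  rw [← ofReal_norm, ← ofReal_norm, h]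

end Summit.NavierStokesRegularity.NavierStokesRegularity.Theorems.PowerGaugeEulerLiouville.NeedleSphericalTonelli
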